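import Mathlib.Analysis.CStarAlgebra.GelfandNaimarkSegal
import Literature.MathematicalPhysics.QuantumLattice.InfiniteVolumeTwistProofs
import Literature.MathematicalPhysics.QuantumLattice.XYOrderDischarges
import Literature.MathematicalPhysics.QuantumLattice.LiebMattisLadder
import HarnessLib

/-!
# Bond algebra for the Affleck–Lieb / LSM theorem (half-odd-integer spin chains)

Trunk **T-QLATTICE**, family `hubbard`, statement **hubbard.S23**. Proof file (theorems only, no
definitions) behind the named facts `not_hasUniqueGappedGroundState_halfOddSpin` and
`no_unique_gapped_groundState_halfOddSpin` of
`Literature/MathematicalPhysics/QuantumLattice/InfiniteVolume.lean` (Affleck–Lieb 1986;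
Tasaki 2022, Cor. 3.6). It records the finite-dimensional operator algebra used by the local-twist
argument (Affleck–Lieb 1986; Tasaki 2018 §3; Tasaki 2022 §3.1), on top of the diagonal twist
`twistOp θ = exp[-i Σ_x θ_x (Ŝᶻ_x + S)]` of `SpinFlipTwist.lean` and its bond identity
`conjTranspose_twistOp_conj_spinDot_add` of `InfiniteVolumeTwistProofs.lean` (both imported):

* product operators under locality and isotony (`productOp_eq_localOp_of_eq_one`,
  `embedOp_productOp`, `embedOp_sum_onSite`; used for the product form of on-site symmetries and
  for sums of single-site operators) and diagonal product / on-site operators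
  (`productOp_diagonal`, `sum_onSite_diagonal`);
* the `U(1)` structure of the exchange operator, `𝐒_x·𝐒_y = ½(S⁺_x S⁻_y + S⁻_x S⁺_y) + Sᶻ_x Sᶻ_y`
  (`spinDot_eq_ladder`; Tasaki 2022, eq. (3.7)), and the imported LSM bond identity rewritten in
  this ladder form, `Uᴴ h U + U h Uᴴ - 2h = (cos(θ_y - θ_x) - 1)(S⁺_x S⁻_y + S⁻_x S⁺_y)`
  (`twistOp_conj_spinDot_add_ladder`);
* the double commutator of a bond with a weighted pair magnetisation,
  `[M, [𝐒_x·𝐒_y, M]] = -((a-b)²/2)(S⁺_x S⁻_y + S⁻_x S⁺_y)` for `M = a Sᶻ_x + b Sᶻ_y`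
  (`pairMagnetization_double_commutator`: it vanishes for `a = b`, the `U(1)` invariance
  `[𝐒_x·𝐒_y, Sᶻ_x + Sᶻ_y] = 0`), and its locality (`comm_weightedMag_eq_pair`,
  `commute_spinDot_onSite_spinZ`);
* a priori bounds for infinite-volume states: `|ω(Sᵅ_x Sᵅ_y)| ≤ S²`,
  `|ω(S⁺_x S⁻_y + S⁻_x S⁺_y)| ≤ 4S² = n²` (from the Loewner bounds of `XYOrderDischarges`), the
  resulting bound on nearest-neighbour bond sums, and three counting lemmas for sums over the
  sites of a region of `ℤ`.

## References

* H. Tasaki, *The Lieb–Schultz–Mattis theorem: a topological point of view*, in: The Physics and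
  Mathematics of Elliott Lieb, vol. 2, EMS Press (2022) 405–446, arXiv:2202.06243 (held), §3.1
  (eq. (3.7); Lemma 3.1 and its proof, eqs. (3.9)–(3.12)). [Tasaki2022]
* H. Tasaki, *Lieb–Schultz–Mattis theorem with a local twist for general one-dimensional quantum
  systems*, J. Stat. Phys. 170 (2018) 653–671, arXiv:1708.05186 (held), §3, Lemma 1. [Tasaki2018]
* I. Affleck, E. H. Lieb, *A proof of part of Haldane's conjecture on spin chains*,
  Lett. Math. Phys. 12 (1986) 57–69 (not held, doi:10.1007/BF00400304). [AffleckLiebLMP1986]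
* H. Tasaki, *Physics and Mathematics of Quantum Many-Body Systems* (Springer 2020), §2.1–2.2.
  [Tasaki2020]
-/

noncomputable section

open Matrix Complex Finset
open scoped ComplexOrder Matrix.Norms.L2Operator

namespace Literature.MathematicalPhysics.QuantumLattice

open Literature.Probability.LatticeModels
open Literature.Probability.LatticeModels (Site)

variable {d q : ℕ}

/-! ### Product operators under locality, isotony and transport -/

section General

variable {Λ : Type*} [Fintype Λ] [DecidableEq Λ]

/-- A product operator whose factors are `1` off `X` is the local operator `(⨂_{x∈X} u_x) ⊗ 𝟙` on
`X`. Bratteli–Robinson II §6.2.1 (`𝔄_X ≅ 𝔄_X ⊗ 𝟙`). [folklore] -/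
theorem productOp_eq_localOp_of_eq_one (X : Finset Λ) {u : Λ → Matrix (Fin q) (Fin q) ℂ}
    (hu : ∀ y, y ∉ X → u y = 1) :
    productOp u = localOp X (productOp fun x : ↥X => u x) := by
  ext σ τ
  rw [productOp_apply, localOp_apply, productOp_apply,
    ← Finset.prod_filter_mul_prod_filter_not univ (fun y : Λ => y ∈ X)]
  have h1 : (univ.filter fun y : Λ => y ∈ X) = X := by
    ext y; simp
  have h2 : (∏ y ∈ univ.filter (fun y : Λ => ¬ y ∈ X), u y (σ y) (τ y)) =
      ∏ y ∈ univ.filter (fun y : Λ => ¬ y ∈ X), (if σ y = τ y then 1 else 0) := by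
    refine Finset.prod_congr rfl fun y hy => ?_
    rw [hu y (Finset.mem_filter.1 hy).2, one_apply]
  rw [h2, Finset.prod_boole, h1, Finset.prod_subtype X (p := fun y => y ∈ X) (fun _ => Iff.rfl)]
  by_cases hc : ∀ y, y ∉ X → σ y = τ y
  · rw [if_pos hc, if_pos, mul_one]
    intro y hy
    exact hc y (Finset.mem_filter.1 hy).2
  · rw [if_neg hc, if_neg, mul_zero]
    intro h
    exact hc fun y hy => h y (Finset.mem_filter.2 ⟨mem_univ _, hy⟩)

/-- Hence such a product operator is supported on `X`. Bratteli–Robinson II §6.2.1. [folklore] -/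
theorem isSupportedOn_productOp_of_eq_one (X : Finset Λ) {u : Λ → Matrix (Fin q) (Fin q) ℂ}
    (hu : ∀ y, y ∉ X → u y = 1) : IsSupportedOn (productOp u) X :=
  ⟨_, (productOp_eq_localOp_of_eq_one X hu).symm⟩

/-- **Transport of a product operator** along a relabelling of sites: `τ_e (⨂_x u_x) = ⨂_y u_{e⁻¹ y}`.
Bratteli–Robinson II §6.2.1, eq. (6.2.2) (covariance). [folklore] -/
theorem transportOp_productOp {X Y : Type*} [Fintype X] [DecidableEq X] [Fintype Y]
    [DecidableEq Y] (e : X ≃ Y) (v : X → Matrix (Fin q) (Fin q) ℂ) :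
    transportOp e (productOp v) = productOp fun y => v (e.symm y) := by
  ext σ τ
  simp only [transportOp, reindex_apply, submatrix_apply, productOp_apply, Equiv.arrowCongr_symm,
    Equiv.arrowCongr_apply, Equiv.refl_symm, Equiv.coe_refl, Function.comp_apply,
    Equiv.symm_symm, Function.comp_def]
  rw [← Equiv.prod_comp e]
  simp only [Equiv.symm_apply_apply]
  rfl

end General

section Regions

/-- **Isotony of product operators**: embedding `⨂_{x∈Λ} f_x` into a larger region extends the
family by `1`, `(⨂_{x∈Λ} f_x) ⊗ 𝟙_{Λ'∖Λ} = ⨂_{y∈Λ'} f_y` when `f = 1` on `Λ' ∖ Λ`.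
Bratteli–Robinson II §6.2.1 (isotony `A ↦ A ⊗ 𝟙`). [folklore] -/
theorem embedOp_productOp {Λ Λ' : Finset (Site d)} (h : Λ ⊆ Λ')
    (f : Site d → Matrix (Fin q) (Fin q) ℂ) (hf : ∀ y ∈ Λ', y ∉ Λ → f y = 1) :
    embedOp h (productOp fun x : ↥Λ => f x) = productOp fun y : ↥Λ' => f y := by
  rw [embedOp_eq_localOp_holds h, transportOp_productOp,
    productOp_eq_localOp_of_eq_one (subFinset Λ Λ') (u := fun y : ↥Λ' => f y)
      (fun y hy => hf y y.2 (fun hyΛ => hy (mem_subFinset.2 hyΛ)))]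
  rfl

/-- Isotony of a sum of single-site operators of a family vanishing off `Λ`:
`(Σ_{x∈Λ} g_x) ⊗ 𝟙 = Σ_{y∈Λ'} g_y`. Bratteli–Robinson II §6.2.1. [folklore] -/
theorem embedOp_sum_onSite {Λ Λ' : Finset (Site d)} (h : Λ ⊆ Λ')
    (g : Site d → Matrix (Fin q) (Fin q) ℂ) (hg : ∀ y ∈ Λ', y ∉ Λ → g y = 0) :
    embedOp h (∑ x : ↥Λ, onSite x (g x)) = ∑ y : ↥Λ', onSite y (g y) := by
  rw [embedOp_sum]
  simp_rw [embedOp_onSite]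
  symm
  rw [← Finset.sum_filter_add_sum_filter_not univ (fun y : ↥Λ' => (y : Site d) ∈ Λ)]
  rw [Finset.sum_eq_zero (s := univ.filter fun y : ↥Λ' => ¬ (y : Site d) ∈ Λ) (fun y hy => by
      rw [hg y y.2 (Finset.mem_filter.1 hy).2]
      ext σ τ; simp [onSite_apply]), add_zero]
  refine Finset.sum_bij' (fun y hy => ⟨y, (Finset.mem_filter.1 hy).2⟩) (fun x _ => ⟨x, h x.2⟩)
    ?_ ?_ ?_ ?_ ?_
  · intro y hy; exact mem_univ _
  · intro x _; exact Finset.mem_filter.2 ⟨mem_univ _, x.2⟩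
  · intro y hy; rfl
  · intro x _; rfl
  · intro y hy; rfl



end Regions

section Diagonal

variable {Λ : Type*} [Fintype Λ] [DecidableEq Λ] {q : ℕ}

omit [DecidableEq Λ] in
/-- A product of diagonal single-site matrices is diagonal in the product basis:
`⨂_x diag(g_x) = diag(σ ↦ ∏_x g_x(σ_x))`. Tasaki (2020) §2.2, eq. (2.2.12). [folklore] -/
theorem productOp_diagonal (g : Λ → Fin q → ℂ) :
    productOp (fun x => diagonal (g x)) =
      (diagonal fun σ : TensorIndex Λ q => ∏ x, g x (σ x)) := by
  ext σ τ
  rw [productOp_apply, diagonal_apply]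
  by_cases h : σ = τ
  · subst h
    rw [if_pos rfl]
    exact Finset.prod_congr rfl fun x _ => diagonal_apply_eq _ _
  · rw [if_neg h]
    obtain ⟨x, hx⟩ := Function.ne_iff.mp h
    exact Finset.prod_eq_zero (Finset.mem_univ x) (diagonal_apply_ne _ hx)

/-- A sum of diagonal single-site operators is diagonal:
`Σ_x diag(g_x)_x = diag(σ ↦ Σ_x g_x(σ_x))`. Tasaki (2020) §2.2. [folklore] -/
theorem sum_onSite_diagonal (s : Finset Λ) (g : Λ → Fin q → ℂ) :
    ∑ x ∈ s, (onSite x (diagonal (g x)) : Op Λ q) = diagonal fun σ => ∑ x ∈ s, g x (σ x) := by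
  simp_rw [LiebMattis.onSite_diagonal]
  ext σ τ
  simp only [Matrix.sum_apply, diagonal_apply]
  split_ifs <;> simp

end Diagonal

section Bond

variable (n : ℕ) {Λ : Type*} [Fintype Λ] [DecidableEq Λ]

/-- **`U(1)` structure of the exchange operator**: for distinct sites,
`𝐒_x · 𝐒_y = ½ (S⁺_x S⁻_y + S⁻_x S⁺_y) + Sᶻ_x Sᶻ_y` (`Sˣ = (S⁺+S⁻)/2`, `Sʸ = (S⁺-S⁻)/2i`).
Tasaki (2022) §3.1, eq. (3.7); Tasaki (2020) §2.4. [cite: Tasaki2022, §3.1 eq. (3.7)] -/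
theorem spinDot_eq_ladder {x y : Λ} (hxy : x ≠ y) :
    spinDot n x y =
      (1 / 2 : ℂ) • ((onSite x (spinRaise n) : Op Λ (n + 1)) * onSite y (spinLower n) +
          onSite x (spinLower n) * onSite y (spinRaise n)) +
        onSite x (SpinOperators.spinZ n) * onSite y (SpinOperators.spinZ n) := by
  have hb : ∀ α : Fin 3, spinBond n α x y = siteSpin n x α * siteSpin n y α := by
    intro α
    rw [spinBond, ← (siteSpin_commute_of_ne_holds n hxy α α).eq, ← two_smul ℂ, smul_smul]
    norm_num
  rw [spinDot, Fin.sum_univ_three, hb, hb, hb]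
  simp only [siteSpin, spinVec_zero, spinVec_one, spinVec_two, spinX, spinY, onSite_smul',
    onSite_add', onSite_sub', smul_mul_smul_comm, one_div_two_mul_I_mul_self]
  simp only [mul_add, add_mul, mul_sub, sub_mul, smul_add, smul_sub, neg_smul]
  module

/-- Single site: `[Sᶻ_x, S⁺_x] = S⁺_x` on the many-body space. Tasaki (2020) §2.1, eq. (2.1.7).
[folklore] -/
theorem onSite_spinZ_comm_spinRaise (x : Λ) :
    (onSite x (SpinOperators.spinZ n) : Op Λ (n + 1)) * onSite x (spinRaise n) -
        onSite x (spinRaise n) * onSite x (SpinOperators.spinZ n) = onSite x (spinRaise n) := by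
  rw [onSite_mul, onSite_mul, ← onSite_sub', spinZ_commutator_spinRaise]

/-- Single site: `[Sᶻ_x, S⁻_x] = -S⁻_x` on the many-body space. Tasaki (2020) §2.1, eq. (2.1.7).
[folklore] -/
theorem onSite_spinZ_comm_spinLower (x : Λ) :
    (onSite x (SpinOperators.spinZ n) : Op Λ (n + 1)) * onSite x (spinLower n) -
        onSite x (spinLower n) * onSite x (SpinOperators.spinZ n) = -onSite x (spinLower n) := by
  rw [onSite_mul, onSite_mul, ← onSite_sub', spinZ_commutator_spinLower, onSite_neg']

/-- Expanding a commutator with `½(A + B) + C` (bilinearity). [folklore] -/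
theorem comm_half_add_add {R : Type*} [Ring R] [Module ℂ R] [IsScalarTower ℂ R R]
    [SMulCommClass ℂ R R] (Z A B C : R) :
    Z * ((1 / 2 : ℂ) • (A + B) + C) - ((1 / 2 : ℂ) • (A + B) + C) * Z =
      (1 / 2 : ℂ) • ((Z * A - A * Z) + (Z * B - B * Z)) + (Z * C - C * Z) := by
  simp only [mul_add, add_mul, mul_smul_comm, smul_mul_assoc, smul_add, smul_sub]
  abel

/-- **The double commutator of the exchange operator with a weighted pair magnetisation**: for
`x ≠ y` and `M = a Sᶻ_x + b Sᶻ_y`, `[M, [𝐒_x·𝐒_y, M]] = -((a-b)²/2) (S⁺_x S⁻_y + S⁻_x S⁺_y)`; in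
particular it vanishes for `a = b` (the `U(1)` invariance `[𝐒_x·𝐒_y, Sᶻ_x + Sᶻ_y] = 0`,
Tasaki 2022 eq. (3.1)), so only bonds across which the weight changes contribute. From
`[Sᶻ_x, S⁺_x S⁻_y] = S⁺_x S⁻_y`, `[Sᶻ_x, S⁻_x S⁺_y] = -S⁻_x S⁺_y` and the `U(1)` structure
`spinDot_eq_ladder`. [cite: Tasaki2022, §3.1 eq. (3.1)] -/
theorem pairMagnetization_double_commutator {x y : Λ} (hxy : x ≠ y) (a b : ℂ) (M : Op Λ (n + 1))
    (hM : M = a • onSite x (SpinOperators.spinZ n) + b • onSite y (SpinOperators.spinZ n)) :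
    M * (spinDot n x y * M - M * spinDot n x y) - (spinDot n x y * M - M * spinDot n x y) * M =
      -((a - b) ^ 2 / 2) •
        ((onSite x (spinRaise n) : Op Λ (n + 1)) * onSite y (spinLower n) +
          onSite x (spinLower n) * onSite y (spinRaise n)) := by
  set Zx : Op Λ (n + 1) := onSite x (SpinOperators.spinZ n) with hZx
  set Zy : Op Λ (n + 1) := onSite y (SpinOperators.spinZ n) with hZy
  set Px : Op Λ (n + 1) := onSite x (spinRaise n) with hPx
  set Py : Op Λ (n + 1) := onSite y (spinRaise n) with hPy
  set Mx : Op Λ (n + 1) := onSite x (spinLower n) with hMx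
  set My : Op Λ (n + 1) := onSite y (spinLower n) with hMy
  set X : Op Λ (n + 1) := Px * My with hX
  set Y : Op Λ (n + 1) := Mx * Py with hY
  -- basic commutators
  have cxP : Zx * Px - Px * Zx = Px := onSite_spinZ_comm_spinRaise n x
  have cxM : Zx * Mx - Mx * Zx = -Mx := onSite_spinZ_comm_spinLower n x
  have cyP : Zy * Py - Py * Zy = Py := onSite_spinZ_comm_spinRaise n y
  have cyM : Zy * My - My * Zy = -My := onSite_spinZ_comm_spinLower n y
  have hMyZx : My * Zx = Zx * My := onSite_mul_onSite_comm hxy.symm _ _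
  have hPyZx : Py * Zx = Zx * Py := onSite_mul_onSite_comm hxy.symm _ _
  have hPxZy : Px * Zy = Zy * Px := onSite_mul_onSite_comm hxy _ _
  have hMxZy : Mx * Zy = Zy * Mx := onSite_mul_onSite_comm hxy _ _
  have hZxZy : Zx * Zy = Zy * Zx := onSite_mul_onSite_comm hxy _ _
  have c1 : Zx * X - X * Zx = X := by
    rw [hX, ← mul_assoc, mul_assoc Px My Zx, hMyZx, ← mul_assoc, ← sub_mul, cxP]
  have c2 : Zx * Y - Y * Zx = -Y := by
    rw [hY, ← mul_assoc, mul_assoc Mx Py Zx, hPyZx, ← mul_assoc, ← sub_mul, cxM, neg_mul]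
  have c3 : Zy * X - X * Zy = -X := by
    rw [hX, ← mul_assoc, ← hPxZy, mul_assoc Px Zy My, mul_assoc Px My Zy, ← mul_sub, cyM, mul_neg]
  have c4 : Zy * Y - Y * Zy = Y := by
    rw [hY, ← mul_assoc, ← hMxZy, mul_assoc Mx Zy Py, mul_assoc Mx Py Zy, ← mul_sub, cyP]
  have c5 : Zx * (Zx * Zy) - Zx * Zy * Zx = 0 := by
    rw [mul_assoc Zx Zy Zx, ← hZxZy, sub_self]
  have c6 : Zy * (Zx * Zy) - Zx * Zy * Zy = 0 := by
    rw [← mul_assoc, ← hZxZy, sub_self]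
  have hD : spinDot n x y = (1 / 2 : ℂ) • (X + Y) + Zx * Zy := spinDot_eq_ladder n hxy
  -- first commutator
  have adx : Zx * spinDot n x y - spinDot n x y * Zx = (1 / 2 : ℂ) • (X - Y) := by
    rw [hD, comm_half_add_add, c1, c2, c5, add_zero, ← sub_eq_add_neg]
  have ady : Zy * spinDot n x y - spinDot n x y * Zy = (1 / 2 : ℂ) • (Y - X) := by
    rw [hD, comm_half_add_add, c3, c4, c6, add_zero, neg_add_eq_sub]
  have e1 : spinDot n x y * M - M * spinDot n x y = ((b - a) / 2) • (X - Y) := by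
    have : spinDot n x y * M - M * spinDot n x y =
        -(a • (Zx * spinDot n x y - spinDot n x y * Zx) + b • (Zy * spinDot n x y - spinDot n x y * Zy)) := by
      rw [hM]
      simp only [mul_add, add_mul, mul_smul_comm, smul_mul_assoc, smul_sub]
      abel
    rw [this, adx, ady, smul_smul, smul_smul]
    module
  -- second commutator
  have adxXY : Zx * (X - Y) - (X - Y) * Zx = X + Y := by
    rw [mul_sub, sub_mul, show Zx * X - Zx * Y - (X * Zx - Y * Zx) = (Zx * X - X * Zx) - (Zx * Y - Y * Zx) by
      abel, c1, c2, sub_neg_eq_add]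
  have adyXY : Zy * (X - Y) - (X - Y) * Zy = -(X + Y) := by
    rw [mul_sub, sub_mul, show Zy * X - Zy * Y - (X * Zy - Y * Zy) = (Zy * X - X * Zy) - (Zy * Y - Y * Zy) by
      abel, c3, c4, neg_add']
  rw [e1, mul_smul_comm, smul_mul_assoc, ← smul_sub]
  have : M * (X - Y) - (X - Y) * M =
      a • (Zx * (X - Y) - (X - Y) * Zx) + b • (Zy * (X - Y) - (X - Y) * Zy) := by
    rw [hM]
    simp only [add_mul, mul_smul_comm, smul_mul_assoc, smul_sub, mul_add]
    abel
  rw [this, adxXY, adyXY]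
  module

/-- **Locality of commutators with a weighted magnetisation**: if `A` commutes with `Sᶻ_z` for all
`z ∉ {x, y}`, then `[A, Σ_z w_z Sᶻ_z] = [A, w_x Sᶻ_x + w_y Sᶻ_y]`. [folklore] -/
theorem comm_weightedMag_eq_pair {x y : Λ} (hxy : x ≠ y) (w : Λ → ℂ) (A : Op Λ (n + 1))
    (hA : ∀ z, z ≠ x → z ≠ y → Commute A (onSite z (SpinOperators.spinZ n))) :
    A * (∑ z, w z • (onSite z (SpinOperators.spinZ n) : Op Λ (n + 1))) -
        (∑ z, w z • (onSite z (SpinOperators.spinZ n) : Op Λ (n + 1))) * A =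
      A * (w x • onSite x (SpinOperators.spinZ n) + w y • onSite y (SpinOperators.spinZ n)) -
        (w x • onSite x (SpinOperators.spinZ n) + w y • onSite y (SpinOperators.spinZ n)) * A := by
  rw [Finset.mul_sum, Finset.sum_mul, ← Finset.sum_sub_distrib,
    Fintype.sum_eq_add x y hxy (fun z hz => ?_)]
  · simp only [mul_add, add_mul]
    abel
  · rw [mul_smul_comm, smul_mul_assoc, (hA z hz.1 hz.2).eq, sub_self]

/-- `Sᶻ_z` commutes with the exchange operator `𝐒_x · 𝐒_y` for `z ∉ {x, y}` (locality,
`siteSpin_commute_of_ne`). Tasaki (2020) §2.2, eq. (2.2.6). [folklore] -/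
theorem commute_spinDot_onSite_spinZ {x y z : Λ} (hzx : z ≠ x) (hzy : z ≠ y) :
    Commute (spinDot n x y) (onSite z (SpinOperators.spinZ n) : Op Λ (n + 1)) := by
  have hz : ∀ u : Λ, z ≠ u → ∀ α : Fin 3,
      Commute (onSite z (SpinOperators.spinZ n) : Op Λ (n + 1)) (siteSpin n u α) := by
    intro u hu α
    have := siteSpin_commute_of_ne_holds (Λ := Λ) n hu 2 α
    rwa [siteSpin, spinVec_two] at this
  refine Commute.symm ?_
  rw [spinDot]
  refine Commute.sum_right _ _ _ fun α _ => ?_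
  rw [spinBond]
  refine Commute.smul_right ?_ _
  exact ((hz x hzx α).mul_right (hz y hzy α)).add_right ((hz y hzy α).mul_right (hz x hzx α))

/-- The first commutator of the exchange operator with a pair magnetisation:
`[𝐒_x·𝐒_y, a Sᶻ_x + b Sᶻ_y] = ((b - a)/2)(S⁺_x S⁻_y - S⁻_x S⁺_y)` for `x ≠ y`.
[cite: Tasaki2022, §3.1 eq. (3.1)] -/
theorem spinDot_comm_pairMagnetization {x y : Λ} (hxy : x ≠ y) (a b : ℂ) :
    spinDot n x y * (a • onSite x (SpinOperators.spinZ n) + b • onSite y (SpinOperators.spinZ n)) -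
        (a • onSite x (SpinOperators.spinZ n) + b • onSite y (SpinOperators.spinZ n)) * spinDot n x y =
      ((b - a) / 2) •
        ((onSite x (spinRaise n) : Op Λ (n + 1)) * onSite y (spinLower n) -
          onSite x (spinLower n) * onSite y (spinRaise n)) := by
  set Zx : Op Λ (n + 1) := onSite x (SpinOperators.spinZ n) with hZx
  set Zy : Op Λ (n + 1) := onSite y (SpinOperators.spinZ n) with hZy
  set Px : Op Λ (n + 1) := onSite x (spinRaise n) with hPx
  set Py : Op Λ (n + 1) := onSite y (spinRaise n) with hPy
  set Mx : Op Λ (n + 1) := onSite x (spinLower n) with hMx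
  set My : Op Λ (n + 1) := onSite y (spinLower n) with hMy
  set X : Op Λ (n + 1) := Px * My with hX
  set Y : Op Λ (n + 1) := Mx * Py with hY
  have cxP : Zx * Px - Px * Zx = Px := onSite_spinZ_comm_spinRaise n x
  have cxM : Zx * Mx - Mx * Zx = -Mx := onSite_spinZ_comm_spinLower n x
  have cyP : Zy * Py - Py * Zy = Py := onSite_spinZ_comm_spinRaise n y
  have cyM : Zy * My - My * Zy = -My := onSite_spinZ_comm_spinLower n y
  have hMyZx : My * Zx = Zx * My := onSite_mul_onSite_comm hxy.symm _ _
  have hPyZx : Py * Zx = Zx * Py := onSite_mul_onSite_comm hxy.symm _ _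
  have hPxZy : Px * Zy = Zy * Px := onSite_mul_onSite_comm hxy _ _
  have hMxZy : Mx * Zy = Zy * Mx := onSite_mul_onSite_comm hxy _ _
  have hZxZy : Zx * Zy = Zy * Zx := onSite_mul_onSite_comm hxy _ _
  have c1 : Zx * X - X * Zx = X := by
    rw [hX, ← mul_assoc, mul_assoc Px My Zx, hMyZx, ← mul_assoc, ← sub_mul, cxP]
  have c2 : Zx * Y - Y * Zx = -Y := by
    rw [hY, ← mul_assoc, mul_assoc Mx Py Zx, hPyZx, ← mul_assoc, ← sub_mul, cxM, neg_mul]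
  have c3 : Zy * X - X * Zy = -X := by
    rw [hX, ← mul_assoc, ← hPxZy, mul_assoc Px Zy My, mul_assoc Px My Zy, ← mul_sub, cyM, mul_neg]
  have c4 : Zy * Y - Y * Zy = Y := by
    rw [hY, ← mul_assoc, ← hMxZy, mul_assoc Mx Zy Py, mul_assoc Mx Py Zy, ← mul_sub, cyP]
  have c5 : Zx * (Zx * Zy) - Zx * Zy * Zx = 0 := by
    rw [mul_assoc Zx Zy Zx, ← hZxZy, sub_self]
  have c6 : Zy * (Zx * Zy) - Zx * Zy * Zy = 0 := by
    rw [← mul_assoc, ← hZxZy, sub_self]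
  have hD : spinDot n x y = (1 / 2 : ℂ) • (X + Y) + Zx * Zy := spinDot_eq_ladder n hxy
  have adx : Zx * spinDot n x y - spinDot n x y * Zx = (1 / 2 : ℂ) • (X - Y) := by
    rw [hD, comm_half_add_add, c1, c2, c5, add_zero, ← sub_eq_add_neg]
  have ady : Zy * spinDot n x y - spinDot n x y * Zy = (1 / 2 : ℂ) • (Y - X) := by
    rw [hD, comm_half_add_add, c3, c4, c6, add_zero, neg_add_eq_sub]
  have : spinDot n x y * (a • Zx + b • Zy) - (a • Zx + b • Zy) * spinDot n x y =
      -(a • (Zx * spinDot n x y - spinDot n x y * Zx) +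
        b • (Zy * spinDot n x y - spinDot n x y * Zy)) := by
    simp only [mul_add, add_mul, mul_smul_comm, smul_mul_assoc, smul_sub]
    abel
  rw [this, adx, ady]
  module

end Bond

section Bounds

variable {d : ℕ} (n : ℕ)

open scoped MatrixOrder in
/-- **A priori bound `|ω(Sᵅ_x Sᵅ_y)| ≤ S²`** for an infinite-volume state (positivity of `ω` on the
Loewner bounds `S²·1 ± Sᵅ_x Sᵅ_y ≥ 0` of `XYOrderDischarges`, `posSemidef_sq_smul_one_sub/add_siteSpin_mul'`;
this replaces the operator-norm bound `|ω(Â)| ≤ ‖Â‖` of Tasaki 2022, after Def. 2.1). [folklore] -/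
theorem InfVolState.norm_expect_siteSpin_mul_le (ω : InfVolState d (n + 1)) (Λ : Finset (Site d))
    (x y : ↥Λ) (α : Fin 3) :
    ‖ω.expect Λ (siteSpin n x α * siteSpin n y α)‖ ≤ ((n : ℝ) / 2) ^ 2 := by
  set z := ω.expect Λ (siteSpin n x α * siteSpin n y α) with hz
  have hc : ω.expect Λ (((n : ℂ) / 2) ^ 2 • (1 : Op ↥Λ (n + 1))) = ((((n : ℝ) / 2) ^ 2 : ℝ) : ℂ) := by
    rw [map_smul, ω.expect_one, smul_eq_mul, mul_one]
    push_cast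
    ring
  have h1 := ω.expect_nonneg_of_nonneg Λ
    (Matrix.nonneg_iff_posSemidef.mpr (posSemidef_sq_smul_one_sub_siteSpin_mul' n x y α))
  have h2 := ω.expect_nonneg_of_nonneg Λ
    (Matrix.nonneg_iff_posSemidef.mpr (posSemidef_sq_smul_one_add_siteSpin_mul' n x y α))
  rw [map_sub, hc] at h1
  rw [map_add, hc] at h2
  rw [← hz] at h1 h2
  obtain ⟨h1r, h1i⟩ := Complex.nonneg_iff.1 h1
  obtain ⟨h2r, h2i⟩ := Complex.nonneg_iff.1 h2
  simp only [Complex.sub_re, Complex.sub_im, Complex.add_re, Complex.add_im, Complex.ofReal_re,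
    Complex.ofReal_im] at h1r h1i h2r h2i
  have him : z.im = 0 := by linarith
  have hre : |z.re| ≤ ((n : ℝ) / 2) ^ 2 := abs_le.2 ⟨by linarith, by linarith⟩
  have : z = (z.re : ℂ) := Complex.ext (by simp) (by simp [him])
  rw [this, Complex.norm_real, Real.norm_eq_abs]
  exact hre

variable {Λ : Type*} [Fintype Λ] [DecidableEq Λ]

/-- `S⁺_x S⁻_y + S⁻_x S⁺_y = 2 (Sˣ_x Sˣ_y + Sʸ_x Sʸ_y)`. Tasaki (2022) §3.1 (eq. before (3.7)).
[cite: Tasaki2022, §3.1 eq. (3.7)] -/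
theorem ladder_sum_eq_two_smul {x y : Λ} (hxy : x ≠ y) :
    (onSite x (spinRaise n) : Op Λ (n + 1)) * onSite y (spinLower n) +
        onSite x (spinLower n) * onSite y (spinRaise n) =
      (2 : ℂ) • (siteSpin n x 0 * siteSpin n y 0 + siteSpin n x 1 * siteSpin n y 1) := by
  have hb : ∀ α : Fin 3, spinBond n α x y = siteSpin n x α * siteSpin n y α := by
    intro α
    rw [spinBond, ← (siteSpin_commute_of_ne_holds n hxy α α).eq, ← two_smul ℂ, smul_smul]
    norm_num
  simp only [siteSpin, spinVec_zero, spinVec_one, spinX, spinY, onSite_smul', onSite_add',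
    onSite_sub', smul_mul_smul_comm, one_div_two_mul_I_mul_self]
  simp only [mul_add, add_mul, mul_sub, sub_mul, smul_add, smul_sub, neg_smul]
  module

end Bounds

section Bounds2

variable {d : ℕ} (n : ℕ)

/-- **`|ω(S⁺_x S⁻_y + S⁻_x S⁺_y)| ≤ 4S² = n²`** for `x ≠ y` and any state `ω`
(cf. Tasaki 2022, eq. (3.12): `‖…‖ ≤ 2J(θ_j - θ_{j+1})² S²`). [folklore] -/
theorem InfVolState.norm_expect_ladder_sum_le (ω : InfVolState d (n + 1)) (Λ : Finset (Site d))
    {x y : ↥Λ} (hxy : x ≠ y) :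
    ‖ω.expect Λ ((onSite x (spinRaise n) : Op ↥Λ (n + 1)) * onSite y (spinLower n) +
        onSite x (spinLower n) * onSite y (spinRaise n))‖ ≤ (n : ℝ) ^ 2 := by
  rw [ladder_sum_eq_two_smul n hxy, map_smul, map_add, norm_smul, Complex.norm_two]
  have h0 := ω.norm_expect_siteSpin_mul_le n Λ x y 0
  have h1 := ω.norm_expect_siteSpin_mul_le n Λ x y 1
  calc 2 * ‖ω.expect Λ (siteSpin n x 0 * siteSpin n y 0) + ω.expect Λ (siteSpin n x 1 * siteSpin n y 1)‖
      ≤ 2 * (((n : ℝ) / 2) ^ 2 + ((n : ℝ) / 2) ^ 2) := by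
        gcongr
        exact (norm_add_le _ _).trans (add_le_add h0 h1)
    _ = (n : ℝ) ^ 2 := by ring

/-- Bounding the expectation of a nearest-neighbour bond sum with coefficients:
`|ω(J Σ_{x, y=x+1} c_{xy}(S⁺_x S⁻_y + S⁻_x S⁺_y))| ≤ |J| Σ_{x, y=x+1} |c_{xy}| n²`. [folklore] -/
theorem InfVolState.norm_expect_bondSum_le (ω : InfVolState 1 (n + 1)) (Λ' : Finset (Site 1))
    (J : ℝ) (c : ↥Λ' → ↥Λ' → ℂ) :
    ‖ω.expect Λ' ((J : ℂ) • ∑ x : ↥Λ', ∑ y : ↥Λ',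
        if (y : Site 1) = (x : Site 1) + 1 then
          c x y • ((onSite x (spinRaise n) : Op ↥Λ' (n + 1)) * onSite y (spinLower n) +
            onSite x (spinLower n) * onSite y (spinRaise n))
        else 0)‖ ≤
      |J| * ∑ x : ↥Λ', ∑ y : ↥Λ',
        if (y : Site 1) = (x : Site 1) + 1 then ‖c x y‖ * (n : ℝ) ^ 2 else 0 := by
  rw [map_smul, norm_smul, Complex.norm_real, Real.norm_eq_abs, map_sum]
  gcongr
  refine (norm_sum_le _ _).trans (Finset.sum_le_sum fun x _ => ?_)
  rw [map_sum]
  refine (norm_sum_le _ _).trans (Finset.sum_le_sum fun y _ => ?_)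
  split_ifs with hxy
  · have hne : x ≠ y := by
      intro e
      have := congrFun (congrArg Subtype.val e) 0
      rw [hxy] at this
      simp at this
    rw [map_smul, norm_smul]
    gcongr
    exact ω.norm_expect_ladder_sum_le n Λ' hne
  · simp

/-- Counting: the inner sum over `{y : y = x + 1}` has at most one term. [folklore] -/
theorem sum_sum_ite_succ_le_sum (Λ' : Finset (Site 1)) (g : ↥Λ' → ℝ) (hg : ∀ x, 0 ≤ g x) :
    ∑ x : ↥Λ', ∑ y : ↥Λ', (if (y : Site 1) = (x : Site 1) + 1 then g x else 0) ≤ ∑ x : ↥Λ', g x := by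
  refine Finset.sum_le_sum fun x _ => ?_
  rw [← Finset.sum_filter, Finset.sum_const, nsmul_eq_mul]
  have hcard : (univ.filter fun y : ↥Λ' => (y : Site 1) = (x : Site 1) + 1).card ≤ 1 := by
    refine Finset.card_le_one.2 fun a ha b hb => ?_
    exact Subtype.ext ((Finset.mem_filter.1 ha).2.trans (Finset.mem_filter.1 hb).2.symm)
  calc ((univ.filter fun y : ↥Λ' => (y : Site 1) = (x : Site 1) + 1).card : ℝ) * g x ≤ 1 * g x := by
        gcongr
        · exact hg x
        · exact_mod_cast hcard
    _ = g x := one_mul _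

/-- Counting: a region has at most `|T|` sites with coordinate in a finite set `T ⊆ ℤ`. [folklore] -/
theorem sum_ite_coord_mem_le (Λ' : Finset (Site 1)) (T : Finset ℤ) (c : ℝ) (hc : 0 ≤ c) :
    ∑ x : ↥Λ', (if (x : Site 1) 0 ∈ T then c else 0) ≤ c * T.card := by
  rw [← Finset.sum_filter, Finset.sum_const, nsmul_eq_mul, mul_comm]
  gcongr
  refine Finset.card_le_card_of_injOn (fun x : ↥Λ' => (x : Site 1) 0) (fun x hx => ?_) ?_
  · exact (Finset.mem_filter.1 hx).2
  · intro a _ b _ hab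
    exact Subtype.ext (funext fun i => by rw [Subsingleton.elim i 0]; exact hab)

/-- Bounding a nearest-neighbour double sum termwise by a function of the left site. [folklore] -/
theorem sum_sum_ite_le_sum (Λ' : Finset (Site 1)) (f : ↥Λ' → ↥Λ' → ℝ) (g : ↥Λ' → ℝ)
    (hfg : ∀ x y : ↥Λ', (y : Site 1) = (x : Site 1) + 1 → f x y ≤ g x) (hg : ∀ x, 0 ≤ g x) :
    ∑ x : ↥Λ', ∑ y : ↥Λ', (if (y : Site 1) = (x : Site 1) + 1 then f x y else 0) ≤ ∑ x : ↥Λ', g x := by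
  refine le_trans (Finset.sum_le_sum fun x _ => Finset.sum_le_sum fun y _ => ?_)
    (sum_sum_ite_succ_le_sum Λ' g hg)
  by_cases hxy : (y : Site 1) = (x : Site 1) + 1
  · rw [if_pos hxy, if_pos hxy]; exact hfg x y hxy
  · rw [if_neg hxy, if_neg hxy]

end Bounds2

section TwistLadder

variable (n : ℕ) {Λ : Type*} [Fintype Λ] [DecidableEq Λ]

/-- **The LSM bond identity in ladder form**: for the diagonal twist `U = U_θ` of
`SpinFlipTwist.lean` and distinct sites, `Uᴴ h U + U h Uᴴ - 2h = (cos(θ_y - θ_x) - 1)(S⁺_x S⁻_y + S⁻_x S⁺_y)`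
for `h = 𝐒_x·𝐒_y` — the imported `conjTranspose_twistOp_conj_spinDot_add`
(`= (2cos(θ_x - θ_y) - 2)(SˣSˣ' + SʸSʸ')`) rewritten with `S⁺S⁻' + S⁻S⁺' = 2(SˣSˣ' + SʸSʸ')`.
Tasaki (2022) §3.1, proof of Lemma 3.1, eq. (3.11). [cite: Tasaki2022, §3.1 Lemma 3.1 (proof)] -/
theorem twistOp_conj_spinDot_add_ladder (θ : Λ → ℝ) {x y : Λ} (hxy : x ≠ y) :
    (twistOp θ)ᴴ * spinDot n x y * twistOp θ + twistOp θ * spinDot n x y * (twistOp θ)ᴴ -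
        (2 : ℂ) • spinDot n x y =
      ((Real.cos (θ y - θ x) - 1 : ℝ) : ℂ) •
        ((onSite x (spinRaise n) : Op Λ (n + 1)) * onSite y (spinLower n) +
          onSite x (spinLower n) * onSite y (spinRaise n)) := by
  have h := conjTranspose_twistOp_conj_spinDot_add n θ hxy
  rw [two_smul] at h
  rw [two_smul, h, ladder_sum_eq_two_smul n hxy, smul_smul]
  have hb : ∀ α : Fin 3, spinBond n α x y = siteSpin n x α * siteSpin n y α := by
    intro α
    rw [spinBond, ← (siteSpin_commute_of_ne_holds n hxy α α).eq, ← two_smul ℂ, smul_smul]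
    norm_num
  rw [hb, hb, Real.cos_sub, Real.cos_sub]
  congr 1
  push_cast
  ring

end TwistLadder

end Literature.MathematicalPhysics.QuantumLattice
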